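import Mathlib.Data.Sym.Card
import Mathlib.Data.Real.Basic
import Literature.Computability.Complexity.SumOfSquaresRefutation
import HarnessLib

/-!
# Grigoriev's linear degree lower bound for the parity principle `MOD2_n`
# ("`K_n` has a perfect matching", `n` odd) in static sum-of-squares (Grigoriev 2001)

A NAMED FACT (cited, not proved here), stated over the tree's static Positivstellensatz /
sum-of-squares refutations `HasSOSRefutation` (`SumOfSquaresRefutation.lean`):

D. Grigoriev, *Linear lower bound on degrees of Positivstellensatz calculus proofs for the parity*,
Theoret. Comput. Sci. 259 (2001) 613–622 [Grigoriev2001TCS] (held: `paper:doi-10-1016-s0304-3975-00-00157-2`).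

* p. 621 (verbatim): "Following [4, 5] we consider (the negation of) mod 2 principle (or the parity)
  as a system of equations in `C(n,2)` variables `X_e` where `e ⊂ {1,…,n}`, `|e| = 2`, denoted by
  `MOD2_n`: `X_e² = X_e`; `X_e X_f = 0` for every `e, f` such that `e ≠ f`, `e ∩ f ≠ ∅`;
  `1 = Σ_{e ∋ i} X_e` for each `i ∈ {1,…,n}`. Obviously, `MOD2_n` is feasible if and only if `n` is
  even."  — `Mod2.system n` below (variables = edges of `K_n`, i.e. non-diagonal unordered pairs of
  `Fin n`; the three groups of equations indexed by `Mod2.Idx n`). A real common zero of `MOD2_n` is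
  exactly the indicator vector of a perfect matching of `K_n`; this is also the constraint set `𝒫_n`
  of Braun–Brown-Cohen–Huq–Pokutta–Raghavendra–Roy–Weitz–Zink, *The matching problem has no small
  symmetric SDP*, Math. Program. 165 (2017), §4.2 (arXiv:1504.00703), through which the fact below
  is the sum-of-squares hardness input of their Theorem 4.10 (restated there as Theorem 4.11).
* p. 622, **Corollary 2** (verbatim): "The degree of any `PC>` refutation of `MOD2_k` is greater than
  `Ω(k)`" [printed "O(k)"; "linear (thereby, sharp) lower bound", same page], obtained from the
  Theorem of §2 (p. 618: "The degree of any `PC>` refutation of a Boolean binomial ideal `P_T` (over a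
  real field) is greater than or equal to `D/2`"), Corollary 1 (Tseitin tautologies `TS_k(2)` on
  6-regular expanders, degree `> Ω(k)`) and the `(4r, 4r)`-reduction of Lemma 10 with Lemma 9.

Degree conventions. Grigoriev's Positivstellensatz calculus `PC>` (Def. 3, p. 616) is a DYNAMIC
system containing the static refutations `PS>` (Def. 2, p. 615) as one-step derivations, and for a
system of EQUATIONS only (no inequality axioms, as in `MOD2_n`) a static `PS>` refutation is
`f + Σ_j e_j² = -1` with `f` in the ideal, of degree `max{deg(f_s g_s), deg(e_j²)}` — which is the
tree's `HasSOSRefutation S d` with HALF-degree `d` (squares `q_l²` with `deg q_l ≤ d`, products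
`g_e · S e` of degree `≤ 2d`), i.e. Grigoriev-degree `≤ 2d`. Hence Corollary 2 implies: there are
`c > 0` and `n₀` such that for `n ≥ n₀` every static refutation `HasSOSRefutation (Mod2.system n) d`
has `2d ≥ c·n`. This consequence — weaker than the printed `PC>` statement, and with the `Ω`
unfolded as "`∃ c > 0, ∃ n₀, ∀ n ≥ n₀`" — is what `Grigoriev2001_mod2Degree` records. (For even `n`
the system is satisfiable, so by soundness `HasSOSRefutation.no_common_zero` it has no refutation
of any degree and the bound is vacuous there; the content is the odd case "`K_{2t+1}` has no
perfect matching needs SOS degree `Ω(t)`".) Modern restatements: Lee–Raghavendra–Steurer STOC 2015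
Thm. 1.12 (the knapsack variant), Potechin / Austrin–Risse 2022, and arXiv:2506.07700 Lemma 2.5.

Contents: `KnEdge n` (edges of `K_n`), `Mod2.Idx n`, `Mod2.system n` with the three unfolding
lemmas, `card_knEdge` (`|E(K_n)| = C(n,2)`), a sanity `example` (`MOD2_1` is refutable in
half-degree `0`, so the threshold `n₀` is needed), the named fact
`Grigoriev2001_mod2Degree`, and its threshold reading `Grigoriev2001_mod2Degree.not_hasSOSRefutation`;
and (proved) "`MOD2_n` is feasible iff `n` is even": `Mod2.no_common_zero_of_odd` (double counting
`Σ_i Σ_{e ∋ i} x_e = 2 Σ_e x_e`, `Mod2.sum_vertex_sums_eq`) and `Mod2.exists_common_zero_of_even` (the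
matching `{0,1}, {2,3}, …`, `Mod2.pmEdge`), which together pin down the encoding.
-/

noncomputable section

open MvPolynomial Finset

namespace Literature.Computability.Complexity

/-- The edge set of the complete graph `K_n` on `Fin n`: unordered pairs `{u, v}` with `u ≠ v`
(the non-diagonal part of `Sym2 (Fin n)`; equal to `(⊤ : SimpleGraph (Fin n)).edgeSet`). These are
the variables `X_e`, `e ⊂ {1,…,n}`, `|e| = 2`, of Grigoriev's `MOD2_n`. [cite: Grigoriev2001TCS, p. 621] -/
abbrev KnEdge (n : ℕ) : Type := {e : Sym2 (Fin n) // ¬ e.IsDiag}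

/-- `|E(K_n)| = C(n, 2)`: `MOD2_n` is "a system of equations in `C(n,2)` variables `X_e`".
[cite: Grigoriev2001TCS, p. 621] -/
theorem card_knEdge (n : ℕ) : Fintype.card (KnEdge n) = n.choose 2 := by
  rw [Sym2.card_subtype_not_diag, Fintype.card_fin]

namespace Mod2

/-- Index set of the equations of `MOD2_n`: one Boolean axiom per edge `e`; one disjointness
equation per ordered pair of distinct edges `e ≠ f` sharing a vertex (`e ∩ f ≠ ∅`); one partition
equation per vertex `i`. [cite: Grigoriev2001TCS, p. 621] -/
abbrev Idx (n : ℕ) : Type :=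
  KnEdge n ⊕
    {p : KnEdge n × KnEdge n //
      p.1 ≠ p.2 ∧ ∃ i : Fin n, i ∈ (p.1 : Sym2 (Fin n)) ∧ i ∈ (p.2 : Sym2 (Fin n))} ⊕
    Fin n

/-- **Grigoriev's system `MOD2_n`** ("the negation of the mod 2 principle, or the parity"), as
real polynomial equations `system n ι = 0` in the edge variables `X_e` of `K_n`:
`X_e² - X_e = 0` (edges), `X_e · X_f = 0` (distinct edges sharing a vertex),
`(Σ_{e ∋ i} X_e) - 1 = 0` (vertices). Its real zeros are exactly the indicator vectors of perfect
matchings of `K_n`; it is feasible iff `n` is even. [cite: Grigoriev2001TCS, p. 621] -/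
def system (n : ℕ) : Idx n → MvPolynomial (KnEdge n) ℝ
  | Sum.inl e => X e ^ 2 - X e
  | Sum.inr (Sum.inl p) => X p.1.1 * X p.1.2
  | Sum.inr (Sum.inr i) => (∑ e ∈ univ.filter (fun e : KnEdge n => i ∈ (e : Sym2 (Fin n))), X e) - 1

/-- Boolean axioms "`X_e² = X_e`". [cite: Grigoriev2001TCS, p. 621] -/
@[simp] theorem system_edge (n : ℕ) (e : KnEdge n) :
    system n (Sum.inl e) = X e ^ 2 - X e := rfl

/-- Disjointness equations "`X_e X_f = 0` for every `e, f` such that `e ≠ f`, `e ∩ f ≠ ∅`".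
[cite: Grigoriev2001TCS, p. 621] -/
@[simp] theorem system_pair (n : ℕ)
    (p : {p : KnEdge n × KnEdge n //
      p.1 ≠ p.2 ∧ ∃ i : Fin n, i ∈ (p.1 : Sym2 (Fin n)) ∧ i ∈ (p.2 : Sym2 (Fin n))}) :
    system n (Sum.inr (Sum.inl p)) = X p.1.1 * X p.1.2 := rfl

/-- Vertex (partition) equations "`1 = Σ_{e ∋ i} X_e` for each `i`". [cite: Grigoriev2001TCS, p. 621] -/
@[simp] theorem system_vertex (n : ℕ) (i : Fin n) :
    system n (Sum.inr (Sum.inr i)) =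
      (∑ e ∈ univ.filter (fun e : KnEdge n => i ∈ (e : Sym2 (Fin n))), X e) - 1 := rfl

/-- At a real point `x`, the vertex equation of `i` evaluates to `(Σ_{e ∋ i} x_e) - 1`
("`1 = Σ_{e ∋ i} X_e` for each `i`"). [cite: Grigoriev2001TCS, p. 621] -/
theorem eval_system_vertex (n : ℕ) (i : Fin n) (x : KnEdge n → ℝ) :
    MvPolynomial.eval x (system n (Sum.inr (Sum.inr i))) =
      (∑ e ∈ univ.filter (fun e : KnEdge n => i ∈ (e : Sym2 (Fin n))), x e) - 1 := by
  simp [system, map_sum]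

/-- `|E(K_1)| = 0`: `K_1` has no edges. [folklore] -/
instance isEmpty_knEdge_one : IsEmpty (KnEdge 1) := by
  rw [← Fintype.card_eq_zero_iff, card_knEdge]; decide

/- Sanity check on the threshold (an `example`, not a catalogued result): for `n = 1` the unique
vertex equation of `MOD2_1` is the constant `-1` (no edges), so `MOD2_1` HAS a static refutation of
half-degree `0` — a bound "`c · n ≤ 2d` for all `n ≥ 1`" would be false, and
`Grigoriev2001_mod2Degree` carries a threshold `n₀` (the printed `Ω(k)`). -/
example : HasSOSRefutation (system 1) 0 := by
  classical
  refine ⟨0, Fin.elim0, fun ι => match ι with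
    | Sum.inr (Sum.inr _) => 1
    | _ => 0, fun l => l.elim0, ?_, ?_⟩
  · rintro (e | p | i)
    · exact (IsEmpty.false e).elim
    · exact (IsEmpty.false p.1.1).elim
    · simp [system]
  · simp [Fintype.sum_sum_type, system, Finset.univ_eq_empty]

end Mod2

/-- **Grigoriev 2001, Corollary 2 (static sum-of-squares form).** "The degree of any `PC>`
refutation of `MOD2_k` is greater than `Ω(k)`" (Theoret. Comput. Sci. 259 (2001), p. 622; a linear,
thereby sharp, bound). Recorded consequence for the tree's static Positivstellensatz refutations of
half-degree `d` (Grigoriev-degree `≤ 2d`; every static `PS>` refutation is a `PC>` refutation of at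
most the same degree): there are a constant `c > 0` and a threshold `n₀` such that for all `n ≥ n₀`,
every sum-of-squares refutation `Σ_l q_l² + Σ_ι g_ι · (MOD2_n)_ι = -1` with `deg q_l ≤ d`,
`deg (g_ι · (MOD2_n)_ι) ≤ 2d` satisfies `c · n ≤ 2d`. (Vacuous for even `n`, where `MOD2_n` is
satisfiable and has no refutation at all; the content is: refuting "`K_n` has a perfect matching"
for odd `n` needs SOS degree linear in `n`.)
-- TODO(general form): the printed statement is for the dynamic Positivstellensatz calculus `PC>`
-- (Def. 3), which the tree does not have; only its static fragment `HasSOSRefutation` is typed.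
[cite: Grigoriev2001TCS, Cor. 2 (p. 622)] -/
def Grigoriev2001_mod2Degree : Prop :=
  ∃ c : ℝ, 0 < c ∧ ∃ n₀ : ℕ, ∀ n : ℕ, n₀ ≤ n → ∀ d : ℕ,
    HasSOSRefutation (Mod2.system n) d → c * n ≤ 2 * d

/-- Threshold reading of `Grigoriev2001_mod2Degree`: below half-degree `c·n/2` there is no static
sum-of-squares refutation of `MOD2_n` (`n` large). [cite: Grigoriev2001TCS, Cor. 2 (p. 622)] -/
theorem Grigoriev2001_mod2Degree.not_hasSOSRefutation (h : Grigoriev2001_mod2Degree) :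
    ∃ c : ℝ, 0 < c ∧ ∃ n₀ : ℕ, ∀ n : ℕ, n₀ ≤ n → ∀ d : ℕ, (2 * d : ℝ) < c * n →
      ¬ HasSOSRefutation (Mod2.system n) d := by
  obtain ⟨c, hc, n₀, H⟩ := h
  exact ⟨c, hc, n₀, fun n hn d hd hS => absurd (H n hn d hS) (not_le.mpr hd)⟩

/-! ### Infeasibility of `MOD2_n` for odd `n` (Grigoriev: "MOD2_n is feasible if and only if n is even") -/

namespace Mod2

/-- A non-diagonal unordered pair `e = {a, b}` of `Fin n` has exactly two elements.
[cite: Grigoriev2001TCS, p. 621 ("e ⊂ {1,…,n}, |e| = 2")] -/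
theorem card_filter_mem_edge {n : ℕ} (e : KnEdge n) :
    (univ.filter fun i : Fin n => i ∈ (e : Sym2 (Fin n))).card = 2 := by
  obtain ⟨e, he⟩ := e
  induction e using Sym2.ind with
  | _ a b =>
    have hab : a ≠ b := by simpa [Sym2.mk_isDiag_iff] using he
    have : (univ.filter fun i : Fin n => i ∈ (s(a, b) : Sym2 (Fin n))) = {a, b} := by
      ext i; simp [Sym2.mem_iff]
    rw [this, card_pair hab]

/-- Double counting vertex–edge incidences: `Σ_i Σ_{e ∋ i} x_e = 2 Σ_e x_e`.
[cite: Grigoriev2001TCS, p. 621] -/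
theorem sum_vertex_sums_eq {n : ℕ} (x : KnEdge n → ℝ) :
    ∑ i : Fin n, ∑ e ∈ univ.filter (fun e : KnEdge n => i ∈ (e : Sym2 (Fin n))), x e =
      2 * ∑ e : KnEdge n, x e := by
  simp_rw [sum_filter]
  rw [sum_comm, mul_sum]
  refine sum_congr rfl fun e _ => ?_
  rw [← sum_filter, sum_const, card_filter_mem_edge, nsmul_eq_mul, Nat.cast_ofNat]

/-- **`MOD2_n` is infeasible for odd `n`** ("Obviously, `MOD2_n` is feasible if and only if `n` is
even" — the "only if" half): for odd `n` the system has no real common zero. At a common zero the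
Boolean axioms force `x_e ∈ {0,1}`, the vertex equations force every vertex to lie on exactly one
chosen edge, and double counting gives `n = 2 · #{e : x_e = 1}`. [cite: Grigoriev2001TCS, p. 621] -/
theorem no_common_zero_of_odd {n : ℕ} (hn : Odd n) (x : KnEdge n → ℝ) :
    ∃ ι, MvPolynomial.eval x (system n ι) ≠ 0 := by
  by_contra h
  push Not at h
  -- Boolean axioms: every `x e` is `0` or `1`.
  have hbool : ∀ e : KnEdge n, x e = 0 ∨ x e = 1 := by
    intro e
    have h1 := h (Sum.inl e)
    simp only [system_edge, map_sub, map_pow, MvPolynomial.eval_X] at h1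
    have : x e * (x e - 1) = 0 := by
      have : x e ^ 2 - x e = x e * (x e - 1) := by ring
      rw [← this]; exact h1
    rcases mul_eq_zero.mp this with h0 | h0
    · exact Or.inl h0
    · exact Or.inr (by linarith)
  -- Vertex equations: `Σ_{e ∋ i} x e = 1`.
  have hvert : ∀ i : Fin n,
      ∑ e ∈ univ.filter (fun e : KnEdge n => i ∈ (e : Sym2 (Fin n))), x e = 1 := by
    intro i
    have h1 := h (Sum.inr (Sum.inr i))
    rw [eval_system_vertex] at h1
    linarith
  -- Double counting.
  have hcount : (n : ℝ) = 2 * ∑ e : KnEdge n, x e := by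
    rw [← sum_vertex_sums_eq x, sum_congr rfl fun i _ => hvert i]
    simp
  -- `Σ_e x e` is a natural number `k`.
  set k : ℕ := (univ.filter fun e : KnEdge n => x e = 1).card with hk
  have hsum : ∑ e : KnEdge n, x e = k := by
    have : ∀ e : KnEdge n, x e = if x e = 1 then (1 : ℝ) else 0 := by
      intro e
      rcases hbool e with h0 | h1
      · rw [h0]; norm_num
      · rw [h1]; norm_num
    rw [sum_congr rfl fun e _ => this e, ← sum_filter, sum_const, nsmul_eq_mul, mul_one]
  rw [hsum] at hcount
  have hn2 : n = 2 * k := by exact_mod_cast hcount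
  exact (Nat.not_even_iff_odd.mpr hn) ⟨k, by omega⟩

end Mod2

/-! ### Feasibility of `MOD2_n` for even `n` (the "if" half): the matching `{0,1}, {2,3}, …` -/

namespace Mod2

/-- The partner of vertex `i` in the perfect matching `{0,1}, {2,3}, …, {n-2,n-1}` of `K_n`
(`n` even): `i + 1` for even `i`, `i - 1` for odd `i`. [cite: Grigoriev2001TCS, p. 621 ("MOD2_n is feasible if and only if n is even")] -/
def partner {n : ℕ} (hn : Even n) (i : Fin n) : Fin n :=
  ⟨if i.val % 2 = 0 then i.val + 1 else i.val - 1, by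
    obtain ⟨k, hk⟩ := hn
    have := i.isLt
    split_ifs with h <;> omega⟩

/-- `partner i ≠ i`. [cite: Grigoriev2001TCS, p. 621] -/
theorem partner_ne {n : ℕ} (hn : Even n) (i : Fin n) : partner hn i ≠ i := by
  intro h
  have hv := congrArg Fin.val h
  simp only [partner] at hv
  split_ifs at hv with h0 <;> omega

/-- `partner` is an involution. [cite: Grigoriev2001TCS, p. 621] -/
theorem partner_partner {n : ℕ} (hn : Even n) (i : Fin n) : partner hn (partner hn i) = i := by
  apply Fin.ext
  simp only [partner]
  split_ifs with h1 h2 h3 <;> omega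

/-- The matching edge `{i, partner i}` of `K_n`. [cite: Grigoriev2001TCS, p. 621] -/
def pmEdge {n : ℕ} (hn : Even n) (i : Fin n) : KnEdge n :=
  ⟨s(i, partner hn i), by rw [Sym2.mk_isDiag_iff]; exact (partner_ne hn i).symm⟩

/-- The two endpoints name the same matching edge. [cite: Grigoriev2001TCS, p. 621] -/
theorem pmEdge_partner {n : ℕ} (hn : Even n) (i : Fin n) : pmEdge hn (partner hn i) = pmEdge hn i := by
  apply Subtype.ext
  simp only [pmEdge, partner_partner]
  exact Sym2.eq_swap

/-- A matching edge through `i` is THE matching edge of `i`. [cite: Grigoriev2001TCS, p. 621] -/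
theorem eq_pmEdge_of_mem {n : ℕ} (hn : Even n) {i j : Fin n} {e : KnEdge n}
    (he : e = pmEdge hn j) (hi : i ∈ (e : Sym2 (Fin n))) : e = pmEdge hn i := by
  subst he
  have hi' : i = j ∨ i = partner hn j := by simpa [pmEdge] using hi
  rcases hi' with rfl | rfl
  · rfl
  · exact (pmEdge_partner hn j).symm

/-- **`MOD2_n` is feasible for even `n`** ("if" half of "feasible iff `n` is even"): the indicator
vector of the perfect matching `{0,1}, {2,3}, …` of `K_n` is a real common zero of all equations of
`MOD2_n`. Together with `no_common_zero_of_odd` this pins down the encoding `system n`.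
[cite: Grigoriev2001TCS, p. 621] -/
theorem exists_common_zero_of_even {n : ℕ} (hn : Even n) :
    ∃ x : KnEdge n → ℝ, ∀ ι, MvPolynomial.eval x (system n ι) = 0 := by
  classical
  let x : KnEdge n → ℝ := fun e => if ∃ j, e = pmEdge hn j then 1 else 0
  have hx : ∀ e : KnEdge n, ∀ i : Fin n, i ∈ (e : Sym2 (Fin n)) →
      x e = if e = pmEdge hn i then 1 else 0 := by
    intro e i hi
    by_cases h : ∃ j, e = pmEdge hn j
    · obtain ⟨j, hj⟩ := h
      have := eq_pmEdge_of_mem hn hj hi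
      simp [x, this]
    · have h' : e ≠ pmEdge hn i := fun h'' => h ⟨i, h''⟩
      simp [x, h, h']
  refine ⟨x, ?_⟩
  rintro (e | p | i)
  · -- Boolean axiom
    simp only [system_edge, map_sub, map_pow, MvPolynomial.eval_X]
    by_cases h : ∃ j, e = pmEdge hn j <;> simp [x, h]
  · -- disjointness: two distinct edges through a common vertex are not both matching edges
    obtain ⟨⟨e, f⟩, hne, i, hie, hif⟩ := p
    simp only [system_pair, map_mul, MvPolynomial.eval_X]
    rw [hx e i hie, hx f i hif]
    by_cases he : e = pmEdge hn i
    · have hf : f ≠ pmEdge hn i := fun hf => hne (he.trans hf.symm)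
      simp [hf]
    · simp [he]
  · -- vertex equation: exactly one matching edge through `i`
    rw [eval_system_vertex, sub_eq_zero]
    rw [sum_congr rfl fun e he => hx e i (Finset.mem_filter.mp he).2]
    rw [sum_ite_eq' (univ.filter fun e : KnEdge n => i ∈ (e : Sym2 (Fin n))) (pmEdge hn i)
      (fun _ => (1 : ℝ))]
    simp [pmEdge]

end Mod2

end Literature.Computability.Complexity
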